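import Literature.Computability.Complexity.Williams2014PreprocMachine
import HarnessLib

/-!
# The preprocessing machine of Williams' Theorem 4.1, II: the copies and the final gate

Literature / circuit complexity, continuing `Williams2014PreprocMachine.lean` (R. Williams,
*Nonuniform ACC circuit lower bounds*, J. ACM 61 (2014), proof of Thm. 4.1: the OR of the
`2^ℓ` restrictions of the input circuit). This file proves the main loop of the preprocessing
machine `P` against the closed form `orCodeList` (`Williams2014PreprocSpec.lean`):

* `wireProg` / `runs_wireProg`: one wire `[t, v]` of copy `a` (offset `A = a (s + 2)`) is
  re-addressed and emitted as the two items of `copyWire ℓ A a` — a gate `j` becomes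
  `A + j + 2` (`gateBranch`), an input `i ≥ ℓ` the input `i - ℓ`, an input `i < ℓ` the constant
  gate `A + bitᵢ(a)` (`inputBranch`, `bitBranch`: the bit is read off the `ℓ`-bit word of `a`
  after dropping `i` bits);
* `gateBody` / `runs_gateBody`: one gate (code, arity `k`, then `k` wires: `wireLoop`);
  `runs_gatesLoop`: all gates of the work copy `GW` (`Com.streamLoop`);
* `copyBody` / `runs_copyBody`, `copiesProg` / `runs_copiesProg`: the `2^ℓ` copies
  (constants `[2, 0, 1, 0]`, a fresh work copy of the gate items, the gates, then
  `A += s + 2` and the word of `a` incremented), emitting `(range 2^ℓ).flatMap copyBlock`;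
* `finalGateProg` / `runs_finalGateProg`: the code (`1` if `ℓ = 0`, else `2`) and arity `2^ℓ`
  of the final `∨`, then its `2^ℓ` re-addressed copies of the output wire.

Costs are uniform polynomial bounds in `n`, `s`, `ℓ`, `G = 2^ℓ (s + 2)` and the fan-in.

## References

* R. Williams, *Nonuniform ACC circuit lower bounds*, J. ACM 61(1) (2014) 2:1–2:32, proof of
  Thm. 4.1 [Williams2014].
* T. Nipkow, G. Klein, *Concrete Semantics with Isabelle/HOL*, Springer 2014, §7.2.
-/

namespace Literature.Computability.Complexity

open SProg Com _root_.Computability GateList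

namespace PreprocP

open PRF

variable {n : ℕ}

/-! ### One wire -/

/-- After dropping `i` bits of the word of `a`, read its top bit `bitᵢ(a)` and emit
`bin (A + bitᵢ(a))` (`X` holds the dropped word, `A` the offset). [folklore] -/
def bitBranch : Com PReg :=
  pop pX (clear pX ;; (nSucc .X .A ;; emitReg pX po pcnt))
    (clear pX ;; (copy pA pX (ra .t) (ra .u) ;; emitReg pX po pcnt)) skip

/-- An input wire `i` (`V = bin i`): compare with `ℓ`; if `i ≥ ℓ` emit `[0, i - ℓ]`, else emit
`1` and the constant gate `A + bitᵢ(a)` (`bitBranch` on the word of `a` with `i` bits dropped).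
[cite: Williams2014, Thm. 4.1] -/
def inputBranch : Com PReg :=
  nCmp .F .V .EL ;;
  pop pF (emitReg pX po pcnt ;; (nSub .V .V .EL ;; emitReg pV po pcnt)) skip
    ((setConst pX [true] ;; emitReg pX po pcnt) ;;
      (copy pAW pX (ra .t) (ra .u) ;; (nToUnary .Vu .V ;; (dropBits pX pVu ptk ;; (clear ptk ;;
        (clear pV ;; bitBranch))))))

/-- A gate wire `j` (`V = bin j`): emit `[1, A + j + 2]`. [cite: Williams2014, Thm. 4.1] -/
def gateBranch : Com PReg :=
  clear pT ;; ((setConst pX [true] ;; emitReg pX po pcnt) ;;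
    (nSucc .V .V ;; (nSucc .V .V ;; (nAdd .V .V .A ;; emitReg pV po pcnt))))

/-- `wireProg`: re-address and emit the wire held in `T` (tag) and `V` (index). [cite: Williams2014, Thm. 4.1] -/
def wireProg : Com PReg := pop pT gateBranch gateBranch inputBranch

/-- A uniform bound on the cost of one wire (`G = 2^ℓ (s + 2)` bounds all offsets and gate
indices in play, `n` the input indices, `ℓ ≤ n`). [folklore] -/
def wireCost (n s ℓ G : ℕ) : ℕ :=
  40 + 72 * (s + 1) + 72 * (s + 2) + 65 * (G + 1) + 4 * G + 56 * (n + 1) + 71 * (n + 1) + 4 * n +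
    10 * ℓ + (n * (16 * n + 21) + 5) + 9 * n + 2 * ℓ + 72 * (G + 1) + 4 * (G + 1) + 10 * G + 4 * G

/-- The index bound of a wire of `C`: inputs are below `n` by typing, a gate wire must point
below `s`. [folklore] -/
def WireOK (s : ℕ) : Fin n ⊕ ℕ → Prop
  | Sum.inl _ => True
  | Sum.inr j => j < s

/-- **The gate branch**: from `T = []` (already popped), `V = bin j`, emit `[1, A + j + 2]`.
[cite: Williams2014, Thm. 4.1] -/
theorem runs_gateBranch {s G A j : ℕ} (hj : j < s) (hA : A + (s + 2) ≤ G) (E : List (List Bool)) (σ : PRF)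
    (hT : σ.T = []) (hV : σ.V = encodeNat j) (hAr : σ.A = encodeNat A) (ho : σ.o = outRev E)
    (hX : σ.X = []) :
    Runs gateBranch (base σ.regs)
      (base { σ with V := [], o := outRev (E ++ [encodeNat 1, encodeNat (A + (j + 2))]), cnt := true :: true :: σ.cnt }.regs)
      (1 + 2 + 8 + 72 * (s + 1) + 72 * (s + 2) + 65 * (G + 1) + (4 * G + 4)) := by
  have hlj := length_encodeNat_le_self j
  have hlA := length_encodeNat_le_self A
  have h1 : Runs (clear pT) (base σ.regs) (base σ.regs) 1 := by
    have h := runs_clear pT (base σ.regs)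
    refine h.of_eq ?_ (by simp [hT])
    simp [← hT]
  set σ₂ : PRF := { σ with X := [true] } with hσ₂
  have h2 : Runs (setConst pX [true]) (base σ.regs) (base σ₂.regs) 2 := by
    have h := runs_setConst pX [true] (base σ.regs)
    refine h.of_eq ?_ ?_
    · simp only [hσ₂]; simp
    · simp [hX]
  set σ₃ : PRF := { σ with X := [], o := outRev (E ++ [encodeNat 1]), cnt := true :: σ.cnt } with hσ₃
  have h3 : Runs (emitReg pX po pcnt) (base σ₂.regs) (base σ₃.regs) (4 * 1 + 4) := by
    have h := runs_emitReg (X := pX) (o := po) (cnt := pcnt) (by decide) (by decide) (by decide) E [true]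
      (base σ₂.regs) (by simp [hσ₂]) (by simp [hσ₂, ho])
    refine h.of_eq ?_ le_rfl
    simp only [hσ₃, hσ₂, encodeNat_one]; simp
  set σ₄ : PRF := { σ₃ with V := encodeNat (j + 1) } with hσ₄
  have h4 : Runs (nSucc .V .V) (base σ₃.regs) (base σ₄.regs) (72 * (s + 1)) := by
    have h := runs_nSucc (β := POwn) .V .V σ₃.regs (n := s) (by simp [hσ₃, hV]; omega) (by simp [hσ₃, hV]; omega)
    refine h.of_eq ?_ le_rfl
    simp only [hσ₄, hσ₃]; simp [hV]
  set σ₅ : PRF := { σ₃ with V := encodeNat (j + 2) } with hσ₅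
  have h5 : Runs (nSucc .V .V) (base σ₄.regs) (base σ₅.regs) (72 * (s + 2)) := by
    have hl := length_encodeNat_le_self (j + 1)
    have h := runs_nSucc (β := POwn) .V .V σ₄.regs (n := s + 1) (by simp [hσ₄]; omega) (by simp [hσ₄]; omega)
    refine h.of_eq ?_ le_rfl
    simp only [hσ₅, hσ₄, hσ₃]; simp
  set σ₆ : PRF := { σ₃ with V := encodeNat (j + 2 + A) } with hσ₆
  have h6 : Runs (nAdd .V .V .A) (base σ₅.regs) (base σ₆.regs) (65 * (G + 1)) := by
    have hl := length_encodeNat_le_self (j + 2)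
    have h := runs_nAdd (β := POwn) .V .V .A σ₅.regs (n := G) (by simp [hσ₅]; omega)
      (by simp [hσ₅, hσ₃, hAr]; omega) (by simp [hσ₅]; omega)
    refine h.of_eq ?_ le_rfl
    simp only [hσ₆, hσ₅, hσ₃]; simp [hAr]
  set σ₇ : PRF := { σ with
    X := [], V := [], o := outRev (E ++ [encodeNat 1, encodeNat (A + (j + 2))]), cnt := true :: true :: σ.cnt } with hσ₇
  have h7 : Runs (emitReg pV po pcnt) (base σ₆.regs) (base σ₇.regs) (4 * (encodeNat (j + 2 + A)).length + 4) := by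
    have h := runs_emitReg (X := pV) (o := po) (cnt := pcnt) (by decide) (by decide) (by decide) (E ++ [encodeNat 1])
      (encodeNat (j + 2 + A)) (base σ₆.regs) (by simp [hσ₆]) (by simp [hσ₆, hσ₃])
    refine h.of_eq ?_ le_rfl
    simp only [hσ₇, hσ₆, hσ₃, List.append_assoc, List.singleton_append, Nat.add_comm A (j + 2)]; simp
  have hl7 := length_encodeNat_le_self (j + 2 + A)
  refine (h1.seq ((h2.seq h3).seq (h4.seq (h5.seq (h6.seq h7))))).of_eq ?_ (by omega)
  simp only [hσ₇]; rw [hX]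

/-- **The bit branch**: from `X = bitᵢ(a) :: rest` (the word of `a` with `i` bits dropped),
emit `bin (A + bitᵢ(a))`. [cite: Williams2014, Thm. 4.1] -/
theorem runs_bitBranch {G A ℓ : ℕ} (b : Bool) (rest : List Bool) (hrest : rest.length ≤ ℓ) (hA : A + 1 ≤ G)
    (E : List (List Bool)) (σ : PRF) (hXr : σ.X = b :: rest) (hAr : σ.A = encodeNat A) (ho : σ.o = outRev E) :
    Runs bitBranch (base σ.regs)
      (base { σ with X := [], o := outRev (E ++ [encodeNat (A + b.toNat)]), cnt := true :: σ.cnt }.regs)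
      (2 + (2 * ℓ + 1) + 72 * (G + 1) + 4 * (G + 1) + 4 + 10 * G + 3 + 4 * G) := by
  have hlA := length_encodeNat_le_self A
  have hlA1 := length_encodeNat_le_self (A + 1)
  set σ₁ : PRF := { σ with X := [] } with hσ₁
  have h1 : Runs (clear pX) (base (Function.update σ.regs .X rest)) (base σ₁.regs) (2 * ℓ + 1) := by
    have h := runs_clear pX (base (Function.update σ.regs .X rest))
    refine h.of_eq ?_ ?_
    · simp only [hσ₁]; simp
    · simp; omega
  cases b
  · -- bit `0`: copy the offset
    set σ₂ : PRF := { σ with X := encodeNat A } with hσ₂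
    have h2 : Runs (copy pA pX (ra .t) (ra .u)) (base σ₁.regs) (base σ₂.regs) (10 * G + 3) := by
      have h := runs_ocopy (β := POwn) (a := .A) (b := .X) (by decide) σ₁.regs
      refine h.of_eq ?_ ?_
      · simp only [hσ₂, hσ₁]; simp [hAr]
      · simp [hσ₁, hAr]; omega
    set σ₃ : PRF := { σ with X := [], o := outRev (E ++ [encodeNat A]), cnt := true :: σ.cnt } with hσ₃
    have h3 : Runs (emitReg pX po pcnt) (base σ₂.regs) (base σ₃.regs) (4 * (encodeNat A).length + 4) := by
      have h := runs_emitReg (X := pX) (o := po) (cnt := pcnt) (by decide) (by decide) (by decide) E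
        (encodeNat A) (base σ₂.regs) (by simp [hσ₂]) (by simp [hσ₂, ho])
      refine h.of_eq ?_ le_rfl
      simp only [hσ₃, hσ₂]; simp
    refine (Runs.opop_false _ _ (by simp [hXr]) (h1.seq (h2.seq h3))).of_eq ?_ (by omega)
    simp only [hσ₃, Bool.toNat_false, Nat.add_zero]
  · -- bit `1`: the successor of the offset
    set σ₂ : PRF := { σ with X := encodeNat (A + 1) } with hσ₂
    have h2 : Runs (nSucc .X .A) (base σ₁.regs) (base σ₂.regs) (72 * (G + 1)) := by
      have h := runs_nSucc (β := POwn) .X .A σ₁.regs (n := G) (by simp [hσ₁, hAr]; omega) (by simp [hσ₁])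
      refine h.of_eq ?_ le_rfl
      simp only [hσ₂, hσ₁]; simp [hAr]
    set σ₃ : PRF := { σ with X := [], o := outRev (E ++ [encodeNat (A + 1)]), cnt := true :: σ.cnt } with hσ₃
    have h3 : Runs (emitReg pX po pcnt) (base σ₂.regs) (base σ₃.regs) (4 * (encodeNat (A + 1)).length + 4) := by
      have h := runs_emitReg (X := pX) (o := po) (cnt := pcnt) (by decide) (by decide) (by decide) E
        (encodeNat (A + 1)) (base σ₂.regs) (by simp [hσ₂]) (by simp [hσ₂, ho])
      refine h.of_eq ?_ le_rfl
      simp only [hσ₃, hσ₂]; simp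
    refine (Runs.opop_true _ _ (by simp [hXr]) (h1.seq (h2.seq h3))).of_eq ?_ (by omega)
    simp only [hσ₃, Bool.toNat_true]

/-- **The input branch**: from `T = []`, `V = bin i` (`i < n`), emit `[0, i - ℓ]` if `i ≥ ℓ`,
else `[1, A + bitᵢ(a)]`. [cite: Williams2014, Thm. 4.1] -/
theorem runs_inputBranch {ℓ G A a i : ℕ} (hi : i < n) (hℓn : ℓ ≤ n) (hA : A + 1 ≤ G)
    (E : List (List Bool)) (σ : PRF) (hV : σ.V = encodeNat i) (hEL : σ.EL = encodeNat ℓ)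
    (hAr : σ.A = encodeNat A) (hAW : σ.AW = natToWord ℓ a) (ho : σ.o = outRev E) (hX : σ.X = [])
    (hF : σ.F = []) (hVu : σ.Vu = []) (htk : σ.tk = []) :
    Runs inputBranch (base σ.regs)
      (base { σ with
        V := []
        o := outRev (E ++ (if i < ℓ then [encodeNat 1, encodeNat (A + (a.testBit i).toNat)]
          else [encodeNat 0, encodeNat (i - ℓ)]))
        cnt := true :: true :: σ.cnt }.regs)
      (56 * (n + 1) + 2 + (4 + 71 * (n + 1) + (4 * n + 4)) + (2 + 8 + (10 * ℓ + 3) + (n * (16 * n + 21) + 5) +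
        (5 * n + 1) + (2 * n + 1) + (2 * n + 1) + (2 + (2 * ℓ + 1) + 72 * (G + 1) + 4 * (G + 1) + 4 + 10 * G + 3 + 4 * G))) := by
  have hli := length_encodeNat_le_self i
  have hlℓ := length_encodeNat_le_self ℓ
  -- the comparison
  set σ₁ : PRF := { σ with F := flag (decide (ℓ ≤ i)) } with hσ₁
  have h1 : Runs (nCmp .F .V .EL) (base σ.regs) (base σ₁.regs) (56 * (n + 1)) := by
    have h := runs_nCmp (β := POwn) .F .V .EL σ.regs (n := n) (by simp [hV]; omega) (by simp [hEL]; omega)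
      (by simp [hF])
    refine h.of_eq ?_ le_rfl
    simp only [hσ₁]; simp [hV, hEL]
  by_cases hℓi : ℓ ≤ i
  · -- `i ≥ ℓ`: the new input `i - ℓ`
    rw [if_neg (not_lt.2 hℓi)]
    have hF1 : σ₁.regs .F = true :: [] := by simp [hσ₁, hℓi]
    set σ₂ : PRF := { σ with F := [], X := [], o := outRev (E ++ [encodeNat 0]), cnt := true :: σ.cnt } with hσ₂
    have h2 : Runs (emitReg pX po pcnt) (base (Function.update σ₁.regs .F [])) (base σ₂.regs) (4 * 0 + 4) := by
      have h := runs_emitReg (X := pX) (o := po) (cnt := pcnt) (by decide) (by decide) (by decide) E []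
        (base (Function.update σ₁.regs .F [])) (by simp [hσ₁, hX]) (by simp [hσ₁, ho])
      refine h.of_eq ?_ le_rfl
      simp only [hσ₂, hσ₁, encodeNat_zero]; simp
    set σ₃ : PRF := { σ₂ with V := encodeNat (i - ℓ) } with hσ₃
    have h3 : Runs (nSub .V .V .EL) (base σ₂.regs) (base σ₃.regs) (71 * (n + 1)) := by
      have h := runs_nSub (β := POwn) .V .V .EL σ₂.regs (n := n) (by simp [hσ₂, hV]; omega)
        (by simp [hσ₂, hEL]; omega) (by simp [hσ₂, hV]; omega) (by simp [hσ₂, hV, hEL, hℓi])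
      refine h.of_eq ?_ le_rfl
      simp only [hσ₃, hσ₂]; simp [hV, hEL]
    set σ₄ : PRF := { σ with
      F := [], X := [], V := [], o := outRev (E ++ [encodeNat 0, encodeNat (i - ℓ)]), cnt := true :: true :: σ.cnt } with hσ₄
    have h4 : Runs (emitReg pV po pcnt) (base σ₃.regs) (base σ₄.regs) (4 * (encodeNat (i - ℓ)).length + 4) := by
      have h := runs_emitReg (X := pV) (o := po) (cnt := pcnt) (by decide) (by decide) (by decide) (E ++ [encodeNat 0])
        (encodeNat (i - ℓ)) (base σ₃.regs) (by simp [hσ₃]) (by simp [hσ₃, hσ₂])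
      refine h.of_eq ?_ le_rfl
      simp only [hσ₄, hσ₃, hσ₂, List.append_assoc, List.singleton_append]; simp
    have hl4 : (encodeNat (i - ℓ)).length ≤ n := (length_encodeNat_le_self _).trans (by omega)
    refine (h1.seq (Runs.opop_true _ _ hF1 (h2.seq (h3.seq h4)))).of_eq ?_ (by omega)
    simp only [hσ₄]; rw [hF, hX]
  · -- `i < ℓ`: the constant gate `A + bitᵢ(a)`
    have hiℓ : i < ℓ := not_le.1 hℓi
    rw [if_pos hiℓ]
    have hF0 : σ₁.regs .F = [] := by simp [hσ₁, hℓi]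
    have e1 : σ₁ = { σ with F := [] } := by rw [hσ₁]; simp [hℓi]
    set σ₂ : PRF := { σ with F := [], X := [true] } with hσ₂
    have h2 : Runs (setConst pX [true]) (base σ₁.regs) (base σ₂.regs) 2 := by
      have h := runs_setConst pX [true] (base σ₁.regs)
      refine h.of_eq ?_ ?_
      · simp only [hσ₂, e1]; simp
      · simp [e1, hX]
    set σ₃ : PRF := { σ with F := [], X := [], o := outRev (E ++ [encodeNat 1]), cnt := true :: σ.cnt } with hσ₃
    have h3 : Runs (emitReg pX po pcnt) (base σ₂.regs) (base σ₃.regs) (4 * 1 + 4) := by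
      have h := runs_emitReg (X := pX) (o := po) (cnt := pcnt) (by decide) (by decide) (by decide) E [true]
        (base σ₂.regs) (by simp [hσ₂]) (by simp [hσ₂, ho])
      refine h.of_eq ?_ le_rfl
      simp only [hσ₃, hσ₂, encodeNat_one]; simp
    set σ₄ : PRF := { σ₃ with X := natToWord ℓ a } with hσ₄
    have h4 : Runs (copy pAW pX (ra .t) (ra .u)) (base σ₃.regs) (base σ₄.regs) (10 * ℓ + 3) := by
      have h := runs_ocopy (β := POwn) (a := .AW) (b := .X) (by decide) σ₃.regs
      refine h.of_eq ?_ ?_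
      · simp only [hσ₄, hσ₃]; simp [hAW]
      · simp [hσ₃, hAW, natToWord]
    set σ₅ : PRF := { σ₄ with Vu := List.replicate i true } with hσ₅
    have h5 : Runs (nToUnary .Vu .V) (base σ₄.regs) (base σ₅.regs) (n * (16 * n + 21) + 5) := by
      have h := runs_nToUnary (β := POwn) .Vu .V σ₄.regs (by simp [hσ₄, hσ₃, hVu])
      refine h.of_eq ?_ ?_
      · simp only [hσ₅, hσ₄, hσ₃]; simp [hV]
      · simp only [hσ₄, hσ₃]; simp [hV]
        exact Nat.mul_le_mul (by omega) (by omega)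
    set σ₆ : PRF := { σ₄ with Vu := [], X := (natToWord ℓ a).drop i, tk := List.replicate i true } with hσ₆
    have h6 : Runs (dropBits pX pVu ptk) (base σ₅.regs) (base σ₆.regs) (5 * n + 1) := by
      have h := runs_dropBits (A := pX) (U := pVu) (V := ptk) (by decide) (by decide) (by decide) i (base σ₅.regs)
        (by simp [hσ₅])
      refine h.of_eq ?_ (by omega)
      simp only [hσ₆, hσ₅, hσ₄, hσ₃]; simp [htk]
    set σ₇ : PRF := { σ₄ with Vu := [], X := (natToWord ℓ a).drop i } with hσ₇
    have h7 : Runs (clear ptk) (base σ₆.regs) (base σ₇.regs) (2 * n + 1) := by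
      have h := runs_clear ptk (base σ₆.regs)
      refine h.of_eq ?_ ?_
      · simp only [hσ₇, hσ₆, hσ₄, hσ₃]; simp [← htk]
      · simp [hσ₆]; omega
    set σ₈ : PRF := { σ with
      F := [], o := outRev (E ++ [encodeNat 1]), cnt := true :: σ.cnt, Vu := [], V := []
      X := (natToWord ℓ a).drop i } with hσ₈
    have h8 : Runs (clear pV) (base σ₇.regs) (base σ₈.regs) (2 * n + 1) := by
      have h := runs_clear pV (base σ₇.regs)
      refine h.of_eq ?_ ?_
      · simp only [hσ₈, hσ₇, hσ₄, hσ₃]; simp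
      · simp [hσ₇, hσ₄, hσ₃, hV]; omega
    have hdrop : (natToWord ℓ a).drop i = a.testBit i :: (natToWord ℓ a).drop (i + 1) := by
      have hil : i < (natToWord ℓ a).length := by simp [natToWord]; exact hiℓ
      rw [List.drop_eq_getElem_cons hil, getElem_natToWord]
    set σ₉ : PRF := { σ with
      F := [], Vu := [], V := [], X := []
      o := outRev (E ++ [encodeNat 1] ++ [encodeNat (A + (a.testBit i).toNat)]), cnt := true :: true :: σ.cnt } with hσ₉
    have h9 : Runs bitBranch (base σ₈.regs) (base σ₉.regs)
        (2 + (2 * ℓ + 1) + 72 * (G + 1) + 4 * (G + 1) + 4 + 10 * G + 3 + 4 * G) := by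
      have h := runs_bitBranch (G := G) (A := A) (ℓ := ℓ) (a.testBit i) ((natToWord ℓ a).drop (i + 1))
        (by simp [natToWord]) hA (E ++ [encodeNat 1]) σ₈ (by simp [hσ₈, hdrop]) (by simp [hσ₈, hAr])
        (by simp [hσ₈])
      refine h.of_eq ?_ le_rfl
      simp only [hσ₉, hσ₈]
    refine (h1.seq (Runs.opop_nil _ _ hF0 (((h2.seq h3).seq (h4.seq (h5.seq (h6.seq (h7.seq (h8.seq h9))))))))).of_eq
      ?_ (by omega)
    simp only [hσ₉, List.append_assoc, List.singleton_append]; rw [hF, hX, hVu]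

/-- **Effect of `wireProg`** on the wire `w` of copy `a` at offset `A` with
`A + s + 2 ≤ G = 2^ℓ (s + 2)`: the two items of `copyWire ℓ A a w` are appended to the reversed
output and counted, `T` and `V` are consumed, within `wireCost n s ℓ G` steps. [cite: Williams2014, Thm. 4.1] -/
theorem runs_wireProg {s ℓ A a : ℕ} (w : Fin n ⊕ ℕ) (hw : WireOK s w) (hℓn : ℓ ≤ n)
    (hA : A + (s + 2) ≤ 2 ^ ℓ * (s + 2)) (E : List (List Bool)) (σ : PRF)
    (hT : σ.T = encodeNat (wtag w)) (hV : σ.V = encodeNat (wval w)) (hEL : σ.EL = encodeNat ℓ)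
    (hAr : σ.A = encodeNat A) (hAW : σ.AW = natToWord ℓ a) (ho : σ.o = outRev E) (hX : σ.X = [])
    (hF : σ.F = []) (hVu : σ.Vu = []) (htk : σ.tk = []) :
    Runs wireProg (base σ.regs)
      (base { σ with T := [], V := [], o := outRev (E ++ (copyWire ℓ A a w).map encodeNat), cnt := true :: true :: σ.cnt }.regs)
      (wireCost n s ℓ (2 ^ ℓ * (s + 2))) := by
  set G := 2 ^ ℓ * (s + 2) with hG
  rcases w with i | j
  · -- an input wire: `T = []`
    simp only [wtag, encodeNat_zero] at hT
    simp only [wval] at hV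
    have h := runs_inputBranch (G := G) i.2 hℓn (by omega) E σ hV hEL hAr hAW ho hX hF hVu htk
    refine (Runs.opop_nil _ _ (by simp [hT]) h).of_eq ?_ ?_
    · simp only [copyWire]
      split_ifs <;> simp [hT]
    · unfold wireCost; omega
  · -- a gate wire: `T = [1]`
    simp only [wtag, encodeNat_one] at hT
    simp only [wval] at hV
    simp only [WireOK] at hw
    set σ' : PRF := { σ with T := [] } with hσ'
    have h := runs_gateBranch (G := G) hw hA E σ' (by simp [hσ']) (by simp [hσ', hV]) (by simp [hσ', hAr])
      (by simp [hσ', ho]) (by simp [hσ', hX])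
    rw [show base σ'.regs = base (Function.update σ.regs .T []) by rw [PRF.update_T]] at h
    refine (Runs.opop_true _ _ (by simp [hT]) h).of_eq ?_ ?_
    · simp only [hσ', copyWire, List.map_cons, List.map_nil]
    · unfold wireCost; omega

/-! ### The wires of a gate -/

/-- The items of a list of wires: tag and index numerals. [folklore] -/
def wireItems (ws : List (Fin n ⊕ ℕ)) : List (List Bool) :=
  ws.flatMap fun w => [encodeNat (wtag w), encodeNat (wval w)]

/-- `wireItems` of a cons. [folklore] -/
theorem wireItems_cons (w : Fin n ⊕ ℕ) (ws : List (Fin n ⊕ ℕ)) :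
    wireItems (w :: ws) = encodeNat (wtag w) :: encodeNat (wval w) :: wireItems ws := rfl

/-- Codes of concatenated item lists. [folklore] -/
theorem encList_append (l₁ l₂ : List (List Bool)) : encList (l₁ ++ l₂) = encList l₁ ++ encList l₂ := by
  induction l₁ with
  | nil => rfl
  | cons a l ih => rw [List.cons_append, encList_cons_eq_dbl, encList_cons_eq_dbl, ih]; simp

/-- `wireBody`: read the tag and the index of the next wire of the work copy, re-address, emit.
[folklore] -/
def wireBody : Com PReg := readItemTo pGW pT pw ptk ;; (readItemTo pGW pV pw ptk ;; wireProg)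

/-- A uniform bound on the cost of `wireBody`. [folklore] -/
def wireStep (n s ℓ G : ℕ) : ℕ := 40 + 11 * (n + s) + wireCost n s ℓ G

/-- The numerals of tags and indices of admissible wires are short. [folklore] -/
theorem length_wval_le {s : ℕ} (w : Fin n ⊕ ℕ) (hw : WireOK s w) : (encodeNat (wval w)).length ≤ n + s := by
  rcases w with i | j
  · exact (length_encodeNat_le_self _).trans (by simp [wval]; omega)
  · simp only [WireOK] at hw
    exact (length_encodeNat_le_self _).trans (by simp [wval]; omega)

/-- Tags are `0` or `1`. [folklore] -/
theorem length_wtag_le (w : Fin n ⊕ ℕ) : (encodeNat (wtag w)).length ≤ 1 := by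
  rcases w with i | j
  · simp [wtag, encodeNat_zero]
  · simp [wtag, encodeNat_one]

/-- **Effect of the wire loop**: with `Ku = 1^{|ws|}` and the items of `ws` at the front of the
work copy, all wires are re-addressed and emitted in order. [cite: Williams2014, Thm. 4.1] -/
theorem runs_wireLoop {s ℓ A a : ℕ} (hℓn : ℓ ≤ n) (hA : A + (s + 2) ≤ 2 ^ ℓ * (s + 2)) (rest : List (List Bool)) :
    ∀ (ws : List (Fin n ⊕ ℕ)) (_ : ∀ w ∈ ws, WireOK s w) (E : List (List Bool)) (σ : PRF),
      σ.Ku = List.replicate ws.length true → σ.GW = encList (wireItems ws ++ rest) → σ.T = [] → σ.V = [] →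
      σ.EL = encodeNat ℓ → σ.A = encodeNat A → σ.AW = natToWord ℓ a → σ.o = outRev E →
      σ.cnt = List.replicate E.length true → σ.X = [] → σ.F = [] → σ.Vu = [] → σ.tk = [] → σ.w = [] →
      Runs (countLoop pKu wireBody) (base σ.regs)
        (base { σ with
          Ku := [], GW := encList rest, o := outRev (E ++ (ws.flatMap (copyWire ℓ A a)).map encodeNat)
          cnt := List.replicate (E ++ (ws.flatMap (copyWire ℓ A a)).map encodeNat).length true }.regs)
        (ws.length * (wireStep n s ℓ (2 ^ ℓ * (s + 2)) + 2) + 1)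
  | [], _, E, σ, hKu, hGW, hT, hV, hEL, hAr, hAW, ho, hcnt, hX, hF, hVu, htk, hw => by
    simp only [List.length_nil, List.replicate_zero] at hKu
    simp only [wireItems, List.flatMap_nil, List.nil_append] at hGW
    refine (Runs.loop_nil _ _ (by simp [hKu])).of_eq ?_ (by simp)
    simp only [List.flatMap_nil, List.map_nil, List.append_nil]
    rw [← hKu, ← hGW, ← ho, ← hcnt]
  | w :: ws, hws, E, σ, hKu, hGW, hT, hV, hEL, hAr, hAW, ho, hcnt, hX, hF, hVu, htk, hw => by
    have hwOK : WireOK s w := hws w (by simp)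
    rw [wireItems_cons, List.cons_append, List.cons_append] at hGW
    -- the body on the first wire
    set σ₀ : PRF := { σ with Ku := List.replicate ws.length true } with hσ₀
    set σ₁ : PRF := { σ₀ with GW := encList (encodeNat (wval w) :: (wireItems ws ++ rest)), T := encodeNat (wtag w) } with hσ₁
    have h1 : Runs (readItemTo pGW pT pw ptk) (base σ₀.regs) (base σ₁.regs) (11 * 1 + 9) := by
      have h := runs_readItemTo (L := pGW) (A := pT) (w := pw) (t := ptk) (by decide) (by decide) (by decide)
        (by decide) (by decide) (encodeNat (wtag w)) (encList (encodeNat (wval w) :: (wireItems ws ++ rest)))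
        (base σ₀.regs) (by simp [hσ₀, hGW, encList_cons_eq_dbl]) (by simp [hσ₀, hw]) (by simp [hσ₀, htk])
      refine h.of_eq ?_ ?_
      · simp only [hσ₁, hσ₀]; simp [hT]
      · have := length_wtag_le w; simp; omega
    set σ₂ : PRF := { σ₀ with GW := encList (wireItems ws ++ rest), T := encodeNat (wtag w), V := encodeNat (wval w) } with hσ₂
    have h2 : Runs (readItemTo pGW pV pw ptk) (base σ₁.regs) (base σ₂.regs) (11 * (n + s) + 9) := by
      have h := runs_readItemTo (L := pGW) (A := pV) (w := pw) (t := ptk) (by decide) (by decide) (by decide)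
        (by decide) (by decide) (encodeNat (wval w)) (encList (wireItems ws ++ rest))
        (base σ₁.regs) (by simp [hσ₁, encList_cons_eq_dbl]) (by simp [hσ₁, hσ₀, hw]) (by simp [hσ₁, hσ₀, htk])
      refine h.of_eq ?_ ?_
      · simp only [hσ₂, hσ₁, hσ₀]; simp [hV]
      · have := length_wval_le w hwOK; simp; omega
    set σ₃ : PRF := { σ₀ with
      GW := encList (wireItems ws ++ rest), o := outRev (E ++ (copyWire ℓ A a w).map encodeNat)
      cnt := true :: true :: σ.cnt } with hσ₃
    have h3 : Runs wireProg (base σ₂.regs) (base σ₃.regs) (wireCost n s ℓ (2 ^ ℓ * (s + 2))) := by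
      have h := runs_wireProg (s := s) (a := a) w hwOK hℓn hA E σ₂ (by simp [hσ₂]) (by simp [hσ₂]) (by simp [hσ₂, hσ₀, hEL])
        (by simp [hσ₂, hσ₀, hAr]) (by simp [hσ₂, hσ₀, hAW]) (by simp [hσ₂, hσ₀, ho]) (by simp [hσ₂, hσ₀, hX])
        (by simp [hσ₂, hσ₀, hF]) (by simp [hσ₂, hσ₀, hVu]) (by simp [hσ₂, hσ₀, htk])
      refine h.of_eq ?_ le_rfl
      simp only [hσ₃, hσ₂, hσ₀]
      rw [hT, hV]
    -- the remaining wires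
    have h4 := runs_wireLoop (a := a) hℓn hA rest ws (fun w' hw' => hws w' (by simp [hw'])) (E ++ (copyWire ℓ A a w).map encodeNat)
      σ₃ (by simp [hσ₃, hσ₀]) (by simp [hσ₃]) (by simp [hσ₃, hσ₀, hT]) (by simp [hσ₃, hσ₀, hV])
      (by simp [hσ₃, hσ₀, hEL]) (by simp [hσ₃, hσ₀, hAr]) (by simp [hσ₃, hσ₀, hAW]) (by simp [hσ₃])
      (by simp [hσ₃, hcnt, List.replicate_succ]) (by simp [hσ₃, hσ₀, hX]) (by simp [hσ₃, hσ₀, hF])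
      (by simp [hσ₃, hσ₀, hVu]) (by simp [hσ₃, hσ₀, htk]) (by simp [hσ₃, hσ₀, hw])
    have hk : (base σ.regs) pKu = true :: List.replicate ws.length true := by simp [hKu, List.replicate_succ]
    refine (Runs.loop_true' hk (by simp [hσ₀]) (h1.seq (h2.seq h3)) h4).of_eq ?_ ?_
    · simp only [hσ₃, hσ₀, List.flatMap_cons, List.map_append, List.append_assoc]
    · simp only [List.length_cons, wireStep]
      generalize wireCost n s ℓ (2 ^ ℓ * (s + 2)) = W
      nlinarith

/-! ### One gate -/

/-- `gateBody`: copy the code item, read the arity `k` (emit it, `Ku := 1ᵏ`), then the `k`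
wires. [cite: Williams2014, Thm. 4.1] -/
def gateBody : Com PReg :=
  readItemTo pGW pX pw ptk ;; (emitReg pX po pcnt ;; (readItemTo pGW pX pw ptk ;; (nToUnary .Ku .X ;;
    (emitReg pX po pcnt ;; countLoop pKu wireBody))))

/-- Symbolic codes are at most `4`. [folklore] -/
theorem accCode_le_four (m : ℕ) (f : GateFn) : accCode m f ≤ 4 := by
  unfold accCode; split_ifs <;> omega

/-- A uniform bound on the cost of a gate of fan-in at most `K`. [folklore] -/
def gateCost (n s ℓ G K : ℕ) : ℕ :=
  (11 * 4 + 9) + (4 * 4 + 4) + (11 * K + 9) + (K * (16 * K + 21) + 5) + (4 * K + 4) +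
    (K * (wireStep n s ℓ G + 2) + 1)

/-- The items of one gate. [folklore] -/
theorem gateCodeList_items (m : ℕ) (g : Gate (Fin n)) :
    (gateCodeList m g).map encodeNat = encodeNat (accCode m g.fn) :: encodeNat g.arity :: wireItems (List.ofFn g.args) := by
  simp only [gateCodeList, List.map_cons, wireItems, List.map_flatMap]
  congr 2
  exact List.flatMap_congr fun w _ => by rw [wireCode_eq]; rfl

/-- **Effect of `gateBody`** on a gate `g` of fan-in `≤ K` whose wires are admissible: its
`copyGate` items are emitted and counted, the work copy advances past the gate.
[cite: Williams2014, Thm. 4.1] -/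
theorem runs_gateBody {m s ℓ A a K : ℕ} (hℓn : ℓ ≤ n) (hA : A + (s + 2) ≤ 2 ^ ℓ * (s + 2)) (g : Gate (Fin n))
    (hg : ∀ i, WireOK s (g.args i)) (hK : g.arity ≤ K) (rest : List (List Bool)) (E : List (List Bool)) (σ : PRF)
    (hGW : σ.GW = encList ((gateCodeList m g).map encodeNat ++ rest)) (hKu : σ.Ku = []) (hT : σ.T = [])
    (hV : σ.V = []) (hEL : σ.EL = encodeNat ℓ) (hAr : σ.A = encodeNat A) (hAW : σ.AW = natToWord ℓ a)
    (ho : σ.o = outRev E) (hcnt : σ.cnt = List.replicate E.length true) (hX : σ.X = []) (hF : σ.F = [])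
    (hVu : σ.Vu = []) (htk : σ.tk = []) (hw : σ.w = []) :
    Runs gateBody (base σ.regs)
      (base { σ with
        GW := encList rest, o := outRev (E ++ (copyGate m ℓ A a g).map encodeNat)
        cnt := List.replicate (E ++ (copyGate m ℓ A a g).map encodeNat).length true }.regs)
      (gateCost n s ℓ (2 ^ ℓ * (s + 2)) K) := by
  rw [gateCodeList_items, List.cons_append, List.cons_append] at hGW
  set c := accCode m g.fn with hc
  have hc4 : (encodeNat c).length ≤ 4 := (length_encodeNat_le_self _).trans (accCode_le_four m g.fn)
  have hkl : (encodeNat g.arity).length ≤ K := (length_encodeNat_le_self _).trans hK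
  -- the code
  set σ₁ : PRF := { σ with GW := encList (encodeNat g.arity :: (wireItems (List.ofFn g.args) ++ rest)), X := encodeNat c } with hσ₁
  have h1 : Runs (readItemTo pGW pX pw ptk) (base σ.regs) (base σ₁.regs) (11 * 4 + 9) := by
    have h := runs_readItemTo (L := pGW) (A := pX) (w := pw) (t := ptk) (by decide) (by decide) (by decide)
      (by decide) (by decide) (encodeNat c) (encList (encodeNat g.arity :: (wireItems (List.ofFn g.args) ++ rest)))
      (base σ.regs) (by simp [hGW, encList_cons_eq_dbl]) (by simp [hw]) (by simp [htk])
    refine h.of_eq ?_ ?_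
    · simp only [hσ₁]; simp [hX]
    · simp; omega
  set σ₂ : PRF := { σ with
    GW := encList (encodeNat g.arity :: (wireItems (List.ofFn g.args) ++ rest)), X := []
    o := outRev (E ++ [encodeNat c]), cnt := true :: σ.cnt } with hσ₂
  have h2 : Runs (emitReg pX po pcnt) (base σ₁.regs) (base σ₂.regs) (4 * 4 + 4) := by
    have h := runs_emitReg (X := pX) (o := po) (cnt := pcnt) (by decide) (by decide) (by decide) E (encodeNat c)
      (base σ₁.regs) (by simp [hσ₁]) (by simp [hσ₁, ho])
    refine h.of_eq ?_ ?_
    · simp only [hσ₂, hσ₁]; simp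
    · omega
  -- the arity
  set σ₃ : PRF := { σ₂ with GW := encList (wireItems (List.ofFn g.args) ++ rest), X := encodeNat g.arity } with hσ₃
  have h3 : Runs (readItemTo pGW pX pw ptk) (base σ₂.regs) (base σ₃.regs) (11 * K + 9) := by
    have h := runs_readItemTo (L := pGW) (A := pX) (w := pw) (t := ptk) (by decide) (by decide) (by decide)
      (by decide) (by decide) (encodeNat g.arity) (encList (wireItems (List.ofFn g.args) ++ rest))
      (base σ₂.regs) (by simp [hσ₂, encList_cons_eq_dbl]) (by simp [hσ₂, hw]) (by simp [hσ₂, htk])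
    refine h.of_eq ?_ ?_
    · simp only [hσ₃, hσ₂]; simp
    · simp; omega
  set σ₄ : PRF := { σ₃ with Ku := List.replicate g.arity true } with hσ₄
  have h4 : Runs (nToUnary .Ku .X) (base σ₃.regs) (base σ₄.regs) (K * (16 * K + 21) + 5) := by
    have h := runs_nToUnary (β := POwn) .Ku .X σ₃.regs (by simp [hσ₃, hσ₂, hKu])
    refine h.of_eq ?_ ?_
    · simp only [hσ₄, hσ₃]; simp
    · simp only [hσ₃]; simp
      exact Nat.mul_le_mul hkl (by omega)
  set σ₅ : PRF := { σ with
    GW := encList (wireItems (List.ofFn g.args) ++ rest), X := [], Ku := List.replicate g.arity true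
    o := outRev (E ++ [encodeNat c, encodeNat g.arity]), cnt := true :: true :: σ.cnt } with hσ₅
  have h5 : Runs (emitReg pX po pcnt) (base σ₄.regs) (base σ₅.regs) (4 * K + 4) := by
    have h := runs_emitReg (X := pX) (o := po) (cnt := pcnt) (by decide) (by decide) (by decide) (E ++ [encodeNat c])
      (encodeNat g.arity) (base σ₄.regs) (by simp [hσ₄, hσ₃]) (by simp [hσ₄, hσ₃, hσ₂])
    refine h.of_eq ?_ ?_
    · simp only [hσ₅, hσ₄, hσ₃, hσ₂, List.append_assoc, List.singleton_append]; simp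
    · omega
  -- the wires
  have h6 := runs_wireLoop (a := a) hℓn hA rest (List.ofFn g.args) (fun w hw' => by
      obtain ⟨i, rfl⟩ := (List.mem_ofFn' _ _).1 hw'; exact hg i)
    (E ++ [encodeNat c, encodeNat g.arity]) σ₅ (by simp [hσ₅]) (by simp [hσ₅]) (by simp [hσ₅, hT])
    (by simp [hσ₅, hV]) (by simp [hσ₅, hEL]) (by simp [hσ₅, hAr]) (by simp [hσ₅, hAW]) (by simp [hσ₅])
    (by simp [hσ₅, hcnt, List.replicate_succ]) (by simp [hσ₅]) (by simp [hσ₅, hF]) (by simp [hσ₅, hVu])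
    (by simp [hσ₅, htk]) (by simp [hσ₅, hw])
  rw [List.length_ofFn] at h6
  refine (h1.seq (h2.seq (h3.seq (h4.seq (h5.seq h6))))).of_eq ?_ ?_
  · simp only [hσ₅, copyGate, List.map_cons, List.cons_append, List.nil_append, List.append_assoc, hc]
    rw [hX, hKu]
  · unfold gateCost
    have : g.arity * (wireStep n s ℓ (2 ^ ℓ * (s + 2)) + 2) ≤ K * (wireStep n s ℓ (2 ^ ℓ * (s + 2)) + 2) :=
      Nat.mul_le_mul_right _ hK
    omega

/-! ### All gates of the work copy -/

/-- The code of a list of gates as held on the work copy. [folklore] -/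
def gatesCode (m : ℕ) (gs : List (Gate (Fin n))) : List Bool := encList ((gs.flatMap (gateCodeList m)).map encodeNat)

/-- `gatesCode` of no gates. [folklore] -/
theorem gatesCode_nil (m : ℕ) : gatesCode m ([] : List (Gate (Fin n))) = [] := rfl

/-- `gatesCode` of a cons. [folklore] -/
theorem gatesCode_cons (m : ℕ) (g : Gate (Fin n)) (gs : List (Gate (Fin n))) :
    gatesCode m (g :: gs) = encList ((gateCodeList m g).map encodeNat ++ (gs.flatMap (gateCodeList m)).map encodeNat) := by
  simp [gatesCode]

/-- A nonempty gate list has a nonempty code. [folklore] -/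
theorem gatesCode_cons_ne_nil (m : ℕ) (g : Gate (Fin n)) (gs : List (Gate (Fin n))) : gatesCode m (g :: gs) ≠ [] := by
  rw [gatesCode_cons, gateCodeList_items, List.cons_append]
  exact encList_cons_ne_nil _ _

/-- The admissibility of a gate for the copy loop: wires in range, fan-in at most `K`. [folklore] -/
def GateOKK (s K : ℕ) (g : Gate (Fin n)) : Prop := (∀ i, WireOK s (g.args i)) ∧ g.arity ≤ K

/-- **Effect of the gate stream** (`Com.streamLoop` over the work copy): all gates are
re-addressed and emitted in order, the work copy is consumed. [cite: Williams2014, Thm. 4.1] -/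
theorem runs_gatesLoop {m s ℓ A a K : ℕ} (hℓn : ℓ ≤ n) (hA : A + (s + 2) ≤ 2 ^ ℓ * (s + 2))
    (gs : List (Gate (Fin n))) (hgs : ∀ g ∈ gs, GateOKK s K g) (E : List (List Bool)) (σ : PRF)
    (hGW : σ.GW = gatesCode m gs) (hKu : σ.Ku = []) (hT : σ.T = []) (hV : σ.V = []) (hEL : σ.EL = encodeNat ℓ)
    (hAr : σ.A = encodeNat A) (hAW : σ.AW = natToWord ℓ a) (ho : σ.o = outRev E)
    (hcnt : σ.cnt = List.replicate E.length true) (hX : σ.X = []) (hF : σ.F = []) (hVu : σ.Vu = [])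
    (htk : σ.tk = []) (hw : σ.w = []) :
    Runs (streamLoop pGW pw gateBody) (base σ.regs)
      (base { σ with
        GW := [], o := outRev (E ++ (gs.flatMap (copyGate m ℓ A a)).map encodeNat)
        cnt := List.replicate (E ++ (gs.flatMap (copyGate m ℓ A a)).map encodeNat).length true }.regs)
      (gs.length * gateCost n s ℓ (2 ^ ℓ * (s + 2)) K + 6 * gs.length + 4) := by
  -- the invariant: the processed prefix has been emitted
  let st : List (Gate (Fin n)) → List (Gate (Fin n)) → PRF := fun done l => { σ with
    GW := gatesCode m l, o := outRev (E ++ (done.flatMap (copyGate m ℓ A a)).map encodeNat)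
    cnt := List.replicate (E ++ (done.flatMap (copyGate m ℓ A a)).map encodeNat).length true }
  let P : List (Gate (Fin n)) → Regs PReg → Prop := fun l R => ∃ done, gs = done ++ l ∧ R = base (st done l).regs
  have hbody : ∀ (g : Gate (Fin n)) (l : List (Gate (Fin n))) (R : Regs PReg), P (g :: l) R →
      R pGW = gatesCode m (g :: l) → R pw = [] → ∃ R', Runs gateBody R R' (gateCost n s ℓ (2 ^ ℓ * (s + 2)) K) ∧
        R' pGW = gatesCode m l ∧ R' pw = [] ∧ P l R' := by
    rintro g l R ⟨done, hsplit, rfl⟩ _ _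
    have hg : GateOKK s K g := hgs g (by rw [hsplit]; simp)
    have h := runs_gateBody (m := m) (a := a) (K := K) hℓn hA g hg.1 hg.2 ((l.flatMap (gateCodeList m)).map encodeNat)
      (E ++ (done.flatMap (copyGate m ℓ A a)).map encodeNat) (st done (g :: l))
      (by simp [st, gatesCode_cons]) (by simp [st, hKu]) (by simp [st, hT]) (by simp [st, hV]) (by simp [st, hEL])
      (by simp [st, hAr]) (by simp [st, hAW]) (by simp [st]) (by simp [st]) (by simp [st, hX]) (by simp [st, hF])
      (by simp [st, hVu]) (by simp [st, htk]) (by simp [st, hw])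
    refine ⟨_, h, by simp [gatesCode], by simp [st, hw], done ++ [g], by rw [hsplit]; simp, ?_⟩
    simp only [st, List.flatMap_append, List.flatMap_cons, List.flatMap_nil, List.append_nil, List.map_append,
      List.append_assoc, gatesCode]
  obtain ⟨R', hrun, hGW', _, ⟨done, hsplit, rfl⟩⟩ := runs_streamLoop (L := pGW) (w := pw) (by decide)
    (gatesCode m) (gatesCode_nil m) (gatesCode_cons_ne_nil m) P (fun _ => gateCost n s ℓ (2 ^ ℓ * (s + 2)) K) hbody
    gs (base σ.regs) ⟨[], by simp, by simp only [st]; simp; rw [← hGW, ← ho, ← hcnt]⟩ (by simp [hGW]) (by simp [hw])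
  rw [List.append_nil] at hsplit
  subst hsplit
  refine hrun.of_eq ?_ ?_
  · simp only [st, gatesCode_nil]
  · rw [List.map_const', List.sum_replicate, smul_eq_mul]

/-! ### One copy -/

/-- `constItems`: emit the codes `[2, 0]`, `[1, 0]` of the two constant gates `∨₀`, `∧₀`.
[folklore] -/
def constItems : Com PReg :=
  (setConst pX [false, true] ;; emitReg pX po pcnt) ;; (emitReg pX po pcnt ;;
    ((setConst pX [true] ;; emitReg pX po pcnt) ;; emitReg pX po pcnt))

/-- Effect of `constItems`. [folklore] -/
theorem runs_constItems (E : List (List Bool)) (σ : PRF) (ho : σ.o = outRev E)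
    (hcnt : σ.cnt = List.replicate E.length true) (hX : σ.X = []) :
    Runs constItems (base σ.regs)
      (base { σ with
        o := outRev (E ++ [encodeNat 2, encodeNat 0, encodeNat 1, encodeNat 0])
        cnt := List.replicate (E.length + 4) true }.regs) 33 := by
  set σ₁ : PRF := { σ with X := [false, true] } with hσ₁
  have h1 : Runs (setConst pX [false, true]) (base σ.regs) (base σ₁.regs) 3 := by
    refine (runs_setConst pX [false, true] (base σ.regs)).of_eq ?_ (by simp [hX])
    simp only [hσ₁]; simp
  set σ₂ : PRF := { σ with X := [], o := outRev (E ++ [encodeNat 2]), cnt := List.replicate (E.length + 1) true } with hσ₂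
  have h2 : Runs (emitReg pX po pcnt) (base σ₁.regs) (base σ₂.regs) (4 * 2 + 4) := by
    have h := runs_emitReg (X := pX) (o := po) (cnt := pcnt) (by decide) (by decide) (by decide) E [false, true]
      (base σ₁.regs) (by simp [hσ₁]) (by simp [hσ₁, ho])
    refine h.of_eq ?_ le_rfl
    simp only [hσ₂, hσ₁, encodeNat_two, List.replicate_succ, hcnt]; simp
  set σ₃ : PRF := { σ with X := [], o := outRev (E ++ [encodeNat 2, encodeNat 0]), cnt := List.replicate (E.length + 2) true } with hσ₃
  have h3 : Runs (emitReg pX po pcnt) (base σ₂.regs) (base σ₃.regs) (4 * 0 + 4) := by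
    have h := runs_emitReg (X := pX) (o := po) (cnt := pcnt) (by decide) (by decide) (by decide) (E ++ [encodeNat 2]) []
      (base σ₂.regs) (by simp [hσ₂]) (by simp [hσ₂])
    refine h.of_eq ?_ le_rfl
    simp only [hσ₃, hσ₂, encodeNat_zero, List.replicate_succ, List.append_assoc, List.singleton_append]; simp
  set σ₄ : PRF := { σ₃ with X := [true] } with hσ₄
  have h4 : Runs (setConst pX [true]) (base σ₃.regs) (base σ₄.regs) 2 := by
    refine (runs_setConst pX [true] (base σ₃.regs)).of_eq ?_ (by simp [hσ₃])
    simp only [hσ₄, hσ₃]; simp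
  set σ₅ : PRF := { σ with
    X := [], o := outRev (E ++ [encodeNat 2, encodeNat 0, encodeNat 1]), cnt := List.replicate (E.length + 3) true } with hσ₅
  have h5 : Runs (emitReg pX po pcnt) (base σ₄.regs) (base σ₅.regs) (4 * 1 + 4) := by
    have h := runs_emitReg (X := pX) (o := po) (cnt := pcnt) (by decide) (by decide) (by decide)
      (E ++ [encodeNat 2, encodeNat 0]) [true] (base σ₄.regs) (by simp [hσ₄]) (by simp [hσ₄, hσ₃])
    refine h.of_eq ?_ le_rfl
    simp only [hσ₅, hσ₄, hσ₃, encodeNat_one, List.replicate_succ, List.append_assoc, List.cons_append,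
      List.nil_append]; simp
  set σ₆ : PRF := { σ with
    X := [], o := outRev (E ++ [encodeNat 2, encodeNat 0, encodeNat 1, encodeNat 0])
    cnt := List.replicate (E.length + 4) true } with hσ₆
  have h6 : Runs (emitReg pX po pcnt) (base σ₅.regs) (base σ₆.regs) (4 * 0 + 4) := by
    have h := runs_emitReg (X := pX) (o := po) (cnt := pcnt) (by decide) (by decide) (by decide)
      (E ++ [encodeNat 2, encodeNat 0, encodeNat 1]) [] (base σ₅.regs) (by simp [hσ₅]) (by simp [hσ₅])
    refine h.of_eq ?_ le_rfl
    simp only [hσ₆, hσ₅, encodeNat_zero, List.replicate_succ, List.append_assoc, List.cons_append,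
      List.nil_append]; simp
  refine ((h1.seq h2).seq (h3.seq ((h4.seq h5).seq h6))).of_eq ?_ (by norm_num)
  simp only [hσ₆]; rw [hX]

/-- `copyBody`: the copy of the current index `a` (offset `A = a (s + 2)` on `A`, word of `a`
on `AW`): the two constants, a fresh work copy of the gate items, all gates re-addressed; then
`A += s + 2` and the word incremented. [cite: Williams2014, Thm. 4.1] -/
def copyBody : Com PReg :=
  constItems ;; (copy pinp pGW (ra .t) (ra .u) ;; (streamLoop pGW pw gateBody ;; (nAdd .A .A .SS ;; incrWord pAW pX pw)))

/-- A uniform bound on the cost of one copy (`I` = length of the code of the gate items).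
[folklore] -/
def copyCost (n s ℓ G K I : ℕ) : ℕ :=
  33 + (10 * I + 3) + (s * gateCost n s ℓ G K + 6 * s + 4) + 65 * (G + 1) + (9 * ℓ + 8)

/-- The admissibility of a circuit for the copy loop: every gate admissible. [folklore] -/
def CircuitOKK (K : ℕ) (C : Circuit (Fin n)) : Prop := ∀ g ∈ C.gates, GateOKK C.size K g

/-- Every circuit is admissible with `K` its maximal fan-in (acyclicity bounds the gate wires).
[folklore] -/
theorem circuitOKK (C : Circuit (Fin n)) : CircuitOKK C.maxFanIn C := by
  intro g hg
  obtain ⟨j, hj, rfl⟩ := List.getElem_of_mem hg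
  refine ⟨fun i => ?_, (Circuit.maxFanIn_le_iff C _).1 le_rfl _ hg⟩
  cases hw : (C.gates[j]).args i with
  | inl _ => trivial
  | inr m' => exact (C.wf j hj i m' hw).trans hj

/-- **Effect of `copyBody`** for the copy `a` with `(a + 1)(s + 2) ≤ 2^ℓ (s + 2)`: the items of
`copyBlock m C ℓ a` are emitted and counted, the offset and the word advance to `a + 1`.
[cite: Williams2014, Thm. 4.1] -/
theorem runs_copyBody {m ℓ K : ℕ} (C : Circuit (Fin n)) (hC : CircuitOKK K C) (hℓn : ℓ ≤ n) (a : ℕ)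
    (ha : (a + 1) * (C.size + 2) ≤ 2 ^ ℓ * (C.size + 2)) (E : List (List Bool)) (σ : PRF)
    (hinp : σ.inp = gatesCode m C.gates) (hGW : σ.GW = []) (hKu : σ.Ku = []) (hT : σ.T = []) (hV : σ.V = [])
    (hEL : σ.EL = encodeNat ℓ) (hSS : σ.SS = encodeNat (C.size + 2)) (hAr : σ.A = encodeNat (a * (C.size + 2)))
    (hAW : σ.AW = natToWord ℓ a) (ho : σ.o = outRev E) (hcnt : σ.cnt = List.replicate E.length true)
    (hX : σ.X = []) (hF : σ.F = []) (hVu : σ.Vu = []) (htk : σ.tk = []) (hw : σ.w = []) :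
    Runs copyBody (base σ.regs)
      (base { σ with
        o := outRev (E ++ (copyBlock m C ℓ a).map encodeNat)
        cnt := List.replicate (E ++ (copyBlock m C ℓ a).map encodeNat).length true
        A := encodeNat ((a + 1) * (C.size + 2)), AW := natToWord ℓ (a + 1) }.regs)
      (copyCost n C.size ℓ (2 ^ ℓ * (C.size + 2)) K (gatesCode m C.gates).length) := by
  have hsz : C.size = C.gates.length := rfl
  have hA : a * (C.size + 2) + (C.size + 2) ≤ 2 ^ ℓ * (C.size + 2) := by rw [← Nat.succ_mul]; exact ha
  -- the constants
  set E₁ := E ++ [encodeNat 2, encodeNat 0, encodeNat 1, encodeNat 0] with hE₁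
  set σ₁ : PRF := { σ with o := outRev E₁, cnt := List.replicate E₁.length true } with hσ₁
  have h1 : Runs constItems (base σ.regs) (base σ₁.regs) 33 := by
    refine (runs_constItems E σ ho hcnt hX).of_eq ?_ le_rfl
    simp only [hσ₁, hE₁, List.length_append]; rfl
  -- the work copy
  set σ₂ : PRF := { σ₁ with GW := gatesCode m C.gates } with hσ₂
  have h2 : Runs (copy pinp pGW (ra .t) (ra .u)) (base σ₁.regs) (base σ₂.regs) (10 * (gatesCode m C.gates).length + 3) := by
    have h := runs_ocopy (β := POwn) (a := .inp) (b := .GW) (by decide) σ₁.regs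
    refine h.of_eq ?_ ?_
    · simp only [hσ₂, hσ₁]; simp [hinp, hGW]
    · simp [hσ₁, hinp]
  -- the gates
  set E₃ := E₁ ++ (C.gates.flatMap (copyGate m ℓ (a * (C.size + 2)) a)).map encodeNat with hE₃
  set σ₃ : PRF := { σ with GW := [], o := outRev E₃, cnt := List.replicate E₃.length true } with hσ₃
  have h3 : Runs (streamLoop pGW pw gateBody) (base σ₂.regs) (base σ₃.regs)
      (C.gates.length * gateCost n C.size ℓ (2 ^ ℓ * (C.size + 2)) K + 6 * C.gates.length + 4) := by
    have h := runs_gatesLoop (m := m) (a := a) (K := K) hℓn hA C.gates hC E₁ σ₂ (by simp [hσ₂]) (by simp [hσ₂, hσ₁, hKu])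
      (by simp [hσ₂, hσ₁, hT]) (by simp [hσ₂, hσ₁, hV]) (by simp [hσ₂, hσ₁, hEL]) (by simp [hσ₂, hσ₁, hAr])
      (by simp [hσ₂, hσ₁, hAW]) (by simp [hσ₂, hσ₁]) (by simp [hσ₂, hσ₁]) (by simp [hσ₂, hσ₁, hX])
      (by simp [hσ₂, hσ₁, hF]) (by simp [hσ₂, hσ₁, hVu]) (by simp [hσ₂, hσ₁, htk]) (by simp [hσ₂, hσ₁, hw])
    refine h.of_eq ?_ le_rfl
    simp only [hσ₃, hσ₂, hσ₁, hE₃]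
  -- the next offset
  set σ₄ : PRF := { σ₃ with A := encodeNat ((a + 1) * (C.size + 2)) } with hσ₄
  have h4 : Runs (nAdd .A .A .SS) (base σ₃.regs) (base σ₄.regs) (65 * (2 ^ ℓ * (C.size + 2) + 1)) := by
    have hl1 := length_encodeNat_le_self (a * (C.size + 2))
    have hl2 := length_encodeNat_le_self (C.size + 2)
    have h := runs_nAdd (β := POwn) .A .A .SS σ₃.regs (n := 2 ^ ℓ * (C.size + 2)) (by simp [hσ₃, hAr]; omega)
      (by simp [hσ₃, hSS]; omega) (by simp [hσ₃, hAr]; omega)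
    refine h.of_eq ?_ le_rfl
    simp only [hσ₄, hσ₃, Nat.succ_mul]; simp [hAr, hSS]
  -- the next word
  set σ₅ : PRF := { σ₄ with AW := natToWord ℓ (a + 1) } with hσ₅
  have h5 : Runs (incrWord pAW pX pw) (base σ₄.regs) (base σ₅.regs) (9 * ℓ + 8) := by
    have h := runs_incrWord (A := pAW) (T := pX) (w := pw) (by decide) (by decide) (by decide) (base σ₄.regs)
      (by simp [hσ₄, hσ₃, hX]) (by simp [hσ₄, hσ₃, hw])
    refine h.of_eq ?_ ?_
    · simp only [hσ₅, hσ₄, hσ₃]; simp [hAW, incrSpec_natToWord]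
    · simp [hσ₄, hσ₃, hAW, natToWord]
  refine (h1.seq (h2.seq (h3.seq (h4.seq h5)))).of_eq ?_ ?_
  · simp only [hσ₅, hσ₄, hσ₃, hE₃, hE₁, copyBlock, List.map_cons, List.append_assoc,
      List.cons_append, List.nil_append]
    rw [hGW]
  · unfold copyCost; rw [hsz]; omega

/-! ### All copies -/

/-- `copiesProg`: one `copyBody` per token of the unary `2^ℓ` on `Lu`. [cite: Williams2014, Thm. 4.1] -/
def copiesProg : Com PReg := countLoop pLu copyBody

/-- **Effect of the copy loop** from copy `a` with `k` copies to go (`a + k = 2^ℓ`): the blocks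
`copyBlock m C ℓ a', a ≤ a' < 2^ℓ` are emitted in order. [cite: Williams2014, Thm. 4.1] -/
theorem runs_copiesLoop {m ℓ K : ℕ} (C : Circuit (Fin n)) (hC : CircuitOKK K C) (hℓn : ℓ ≤ n) :
    ∀ (k a : ℕ) (_ : a + k = 2 ^ ℓ) (E : List (List Bool)) (σ : PRF),
      σ.Lu = List.replicate k true → σ.inp = gatesCode m C.gates → σ.GW = [] → σ.Ku = [] → σ.T = [] → σ.V = [] →
      σ.EL = encodeNat ℓ → σ.SS = encodeNat (C.size + 2) → σ.A = encodeNat (a * (C.size + 2)) →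
      σ.AW = natToWord ℓ a → σ.o = outRev E → σ.cnt = List.replicate E.length true → σ.X = [] → σ.F = [] →
      σ.Vu = [] → σ.tk = [] → σ.w = [] →
      Runs copiesProg (base σ.regs)
        (base { σ with
          Lu := [], o := outRev (E ++ ((List.range' a k).flatMap (copyBlock m C ℓ)).map encodeNat)
          cnt := List.replicate (E ++ ((List.range' a k).flatMap (copyBlock m C ℓ)).map encodeNat).length true
          A := encodeNat (2 ^ ℓ * (C.size + 2)), AW := natToWord ℓ (2 ^ ℓ) }.regs)
        (k * (copyCost n C.size ℓ (2 ^ ℓ * (C.size + 2)) K (gatesCode m C.gates).length + 2) + 1)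
  | 0, a, hak, E, σ, hLu, hinp, hGW, hKu, hT, hV, hEL, hSS, hAr, hAW, ho, hcnt, hX, hF, hVu, htk, hw => by
    simp only [List.replicate_zero] at hLu
    rw [Nat.add_zero] at hak
    subst hak
    refine (Runs.loop_nil _ _ (by simp [hLu])).of_eq ?_ (by simp)
    simp only [List.range'_zero, List.flatMap_nil, List.map_nil, List.append_nil]
    rw [← hLu, ← hAr, ← hAW, ← ho, ← hcnt]
  | k + 1, a, hak, E, σ, hLu, hinp, hGW, hKu, hT, hV, hEL, hSS, hAr, hAW, ho, hcnt, hX, hF, hVu, htk, hw => by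
    have ha : (a + 1) * (C.size + 2) ≤ 2 ^ ℓ * (C.size + 2) := Nat.mul_le_mul_right _ (by omega)
    set σ₀ : PRF := { σ with Lu := List.replicate k true } with hσ₀
    have h1 := runs_copyBody (m := m) C hC hℓn a ha E σ₀ (by simp [hσ₀, hinp]) (by simp [hσ₀, hGW]) (by simp [hσ₀, hKu])
      (by simp [hσ₀, hT]) (by simp [hσ₀, hV]) (by simp [hσ₀, hEL]) (by simp [hσ₀, hSS]) (by simp [hσ₀, hAr])
      (by simp [hσ₀, hAW]) (by simp [hσ₀, ho]) (by simp [hσ₀, hcnt]) (by simp [hσ₀, hX]) (by simp [hσ₀, hF])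
      (by simp [hσ₀, hVu]) (by simp [hσ₀, htk]) (by simp [hσ₀, hw])
    set E₁ := E ++ (copyBlock m C ℓ a).map encodeNat with hE₁
    set σ₁ : PRF := { σ₀ with
      o := outRev E₁, cnt := List.replicate E₁.length true
      A := encodeNat ((a + 1) * (C.size + 2)), AW := natToWord ℓ (a + 1) } with hσ₁
    have h2 := runs_copiesLoop (m := m) C hC hℓn k (a + 1) (by omega) E₁ σ₁ (by simp [hσ₁, hσ₀]) (by simp [hσ₁, hσ₀, hinp])
      (by simp [hσ₁, hσ₀, hGW]) (by simp [hσ₁, hσ₀, hKu]) (by simp [hσ₁, hσ₀, hT]) (by simp [hσ₁, hσ₀, hV])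
      (by simp [hσ₁, hσ₀, hEL]) (by simp [hσ₁, hσ₀, hSS]) (by simp [hσ₁]) (by simp [hσ₁]) (by simp [hσ₁])
      (by simp [hσ₁]) (by simp [hσ₁, hσ₀, hX]) (by simp [hσ₁, hσ₀, hF]) (by simp [hσ₁, hσ₀, hVu])
      (by simp [hσ₁, hσ₀, htk]) (by simp [hσ₁, hσ₀, hw])
    have hk : (base σ.regs) pLu = true :: List.replicate k true := by simp [hLu, List.replicate_succ]
    refine (Runs.loop_true' hk (by simp [hσ₀]) (h1.of_eq (by simp only [hσ₁, hE₁]) le_rfl) h2).of_eq ?_ ?_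
    · simp only [hσ₁, hσ₀, hE₁, List.range'_succ, List.flatMap_cons, List.map_append, List.append_assoc]
    · generalize copyCost n C.size ℓ (2 ^ ℓ * (C.size + 2)) K (gatesCode m C.gates).length = W
      nlinarith

/-! ### The final gate -/

/-- `outBody`: one copy of the output wire, re-addressed for the current copy index. [cite: Williams2014, Thm. 4.1] -/
def outBody : Com PReg :=
  copy pTO pT (ra .t) (ra .u) ;; (copy pVO pV (ra .t) (ra .u) ;; (wireProg ;; (nAdd .A .A .SS ;; incrWord pAW pX pw)))

/-- A uniform bound on the cost of `outBody`. [folklore] -/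
def outStep (n s ℓ G : ℕ) : ℕ := (10 * 1 + 3) + (10 * (n + s) + 3) + wireCost n s ℓ G + 65 * (G + 1) + (9 * ℓ + 8)

/-- The output wire of a circuit is admissible. [folklore] -/
theorem wireOK_output (C : Circuit (Fin n)) : WireOK C.size C.output := by
  cases h : C.output with
  | inl _ => trivial
  | inr m => exact C.wf_output m h

/-- **Effect of the output-wire loop** from copy `a` with `k` copies to go (`a + k = 2^ℓ`): the
re-addressed output wires of the copies `a ≤ a' < 2^ℓ` are emitted in order.
[cite: Williams2014, Thm. 4.1] -/
theorem runs_outLoop {ℓ : ℕ} (C : Circuit (Fin n)) (hℓn : ℓ ≤ n) :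
    ∀ (k a : ℕ) (_ : a + k = 2 ^ ℓ) (E : List (List Bool)) (σ : PRF),
      σ.Lu = List.replicate k true → σ.TO = encodeNat (wtag C.output) → σ.VO = encodeNat (wval C.output) →
      σ.T = [] → σ.V = [] → σ.EL = encodeNat ℓ → σ.SS = encodeNat (C.size + 2) →
      σ.A = encodeNat (a * (C.size + 2)) → σ.AW = natToWord ℓ a → σ.o = outRev E →
      σ.cnt = List.replicate E.length true → σ.X = [] → σ.F = [] → σ.Vu = [] → σ.tk = [] → σ.w = [] →
      Runs (countLoop pLu outBody) (base σ.regs)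
        (base { σ with
          Lu := []
          o := outRev (E ++ ((List.range' a k).flatMap fun a' => copyWire ℓ (a' * (C.size + 2)) a' C.output).map encodeNat)
          cnt := List.replicate (E ++ ((List.range' a k).flatMap fun a' =>
            copyWire ℓ (a' * (C.size + 2)) a' C.output).map encodeNat).length true
          A := encodeNat (2 ^ ℓ * (C.size + 2)), AW := natToWord ℓ (2 ^ ℓ) }.regs)
        (k * (outStep n C.size ℓ (2 ^ ℓ * (C.size + 2)) + 2) + 1)
  | 0, a, hak, E, σ, hLu, hTO, hVO, hT, hV, hEL, hSS, hAr, hAW, ho, hcnt, hX, hF, hVu, htk, hw => by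
    simp only [List.replicate_zero] at hLu
    rw [Nat.add_zero] at hak
    subst hak
    refine (Runs.loop_nil _ _ (by simp [hLu])).of_eq ?_ (by simp)
    simp only [List.range'_zero, List.flatMap_nil, List.map_nil, List.append_nil]
    rw [← hLu, ← hAr, ← hAW, ← ho, ← hcnt]
  | k + 1, a, hak, E, σ, hLu, hTO, hVO, hT, hV, hEL, hSS, hAr, hAW, ho, hcnt, hX, hF, hVu, htk, hw => by
    have hA : a * (C.size + 2) + (C.size + 2) ≤ 2 ^ ℓ * (C.size + 2) := by
      rw [← Nat.succ_mul]; exact Nat.mul_le_mul_right _ (by omega)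
    have hlt := length_wtag_le C.output
    have hlv := length_wval_le C.output (wireOK_output C)
    set σ₀ : PRF := { σ with Lu := List.replicate k true } with hσ₀
    -- the operands
    set σ₁ : PRF := { σ₀ with T := encodeNat (wtag C.output) } with hσ₁
    have h1 : Runs (copy pTO pT (ra .t) (ra .u)) (base σ₀.regs) (base σ₁.regs) (10 * 1 + 3) := by
      have h := runs_ocopy (β := POwn) (a := .TO) (b := .T) (by decide) σ₀.regs
      refine h.of_eq ?_ ?_
      · simp only [hσ₁, hσ₀]; simp [hTO, hT]
      · simp [hσ₀, hTO]; omega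
    set σ₂ : PRF := { σ₁ with V := encodeNat (wval C.output) } with hσ₂
    have h2 : Runs (copy pVO pV (ra .t) (ra .u)) (base σ₁.regs) (base σ₂.regs) (10 * (n + C.size) + 3) := by
      have h := runs_ocopy (β := POwn) (a := .VO) (b := .V) (by decide) σ₁.regs
      refine h.of_eq ?_ ?_
      · simp only [hσ₂, hσ₁, hσ₀]; simp [hVO, hV]
      · simp [hσ₁, hσ₀, hVO]; omega
    -- the wire
    set E₃ := E ++ (copyWire ℓ (a * (C.size + 2)) a C.output).map encodeNat with hE₃
    set σ₃ : PRF := { σ₀ with o := outRev E₃, cnt := List.replicate E₃.length true } with hσ₃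
    have h3 : Runs wireProg (base σ₂.regs) (base σ₃.regs) (wireCost n C.size ℓ (2 ^ ℓ * (C.size + 2))) := by
      have h := runs_wireProg (s := C.size) (a := a) C.output (wireOK_output C) hℓn hA E σ₂ (by simp [hσ₂, hσ₁])
        (by simp [hσ₂]) (by simp [hσ₂, hσ₁, hσ₀, hEL]) (by simp [hσ₂, hσ₁, hσ₀, hAr]) (by simp [hσ₂, hσ₁, hσ₀, hAW])
        (by simp [hσ₂, hσ₁, hσ₀, ho]) (by simp [hσ₂, hσ₁, hσ₀, hX]) (by simp [hσ₂, hσ₁, hσ₀, hF])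
        (by simp [hσ₂, hσ₁, hσ₀, hVu]) (by simp [hσ₂, hσ₁, hσ₀, htk])
      refine h.of_eq ?_ le_rfl
      simp only [hσ₃, hσ₂, hσ₁, hσ₀, hE₃, List.length_append, List.replicate_add, hcnt]; simp
      rw [hT, hV]
    -- the next offset and word
    set σ₄ : PRF := { σ₃ with A := encodeNat ((a + 1) * (C.size + 2)) } with hσ₄
    have h4 : Runs (nAdd .A .A .SS) (base σ₃.regs) (base σ₄.regs) (65 * (2 ^ ℓ * (C.size + 2) + 1)) := by
      have hl1 := length_encodeNat_le_self (a * (C.size + 2))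
      have hl2 := length_encodeNat_le_self (C.size + 2)
      have h := runs_nAdd (β := POwn) .A .A .SS σ₃.regs (n := 2 ^ ℓ * (C.size + 2)) (by simp [hσ₃, hσ₀, hAr]; omega)
        (by simp [hσ₃, hσ₀, hSS]; omega) (by simp [hσ₃, hσ₀, hAr]; omega)
      refine h.of_eq ?_ le_rfl
      simp only [hσ₄, hσ₃, hσ₀, Nat.succ_mul]; simp [hAr, hSS]
    set σ₅ : PRF := { σ₄ with AW := natToWord ℓ (a + 1) } with hσ₅
    have h5 : Runs (incrWord pAW pX pw) (base σ₄.regs) (base σ₅.regs) (9 * ℓ + 8) := by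
      have h := runs_incrWord (A := pAW) (T := pX) (w := pw) (by decide) (by decide) (by decide) (base σ₄.regs)
        (by simp [hσ₄, hσ₃, hσ₀, hX]) (by simp [hσ₄, hσ₃, hσ₀, hw])
      refine h.of_eq ?_ ?_
      · simp only [hσ₅, hσ₄, hσ₃, hσ₀]; simp [hAW, incrSpec_natToWord]
      · simp [hσ₄, hσ₃, hσ₀, hAW, natToWord]
    -- the remaining copies
    have h6 := runs_outLoop C hℓn k (a + 1) (by omega) E₃ σ₅ (by simp [hσ₅, hσ₄, hσ₃, hσ₀]) (by simp [hσ₅, hσ₄, hσ₃, hσ₀, hTO])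
      (by simp [hσ₅, hσ₄, hσ₃, hσ₀, hVO]) (by simp [hσ₅, hσ₄, hσ₃, hσ₀, hT]) (by simp [hσ₅, hσ₄, hσ₃, hσ₀, hV])
      (by simp [hσ₅, hσ₄, hσ₃, hσ₀, hEL]) (by simp [hσ₅, hσ₄, hσ₃, hσ₀, hSS]) (by simp [hσ₅, hσ₄]) (by simp [hσ₅])
      (by simp [hσ₅, hσ₄, hσ₃]) (by simp [hσ₅, hσ₄, hσ₃]) (by simp [hσ₅, hσ₄, hσ₃, hσ₀, hX])
      (by simp [hσ₅, hσ₄, hσ₃, hσ₀, hF]) (by simp [hσ₅, hσ₄, hσ₃, hσ₀, hVu]) (by simp [hσ₅, hσ₄, hσ₃, hσ₀, htk])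
      (by simp [hσ₅, hσ₄, hσ₃, hσ₀, hw])
    have hk : (base σ.regs) pLu = true :: List.replicate k true := by simp [hLu, List.replicate_succ]
    refine (Runs.loop_true' hk (by simp [hσ₀]) (h1.seq (h2.seq (h3.seq (h4.seq h5)))) h6).of_eq ?_ ?_
    · simp only [hσ₅, hσ₄, hσ₃, hσ₀, hE₃, List.range'_succ, List.flatMap_cons, List.map_append, List.append_assoc]
    · simp only [outStep]
      generalize wireCost n C.size ℓ (2 ^ ℓ * (C.size + 2)) = W
      nlinarith

/-- `finalGateProg`: the code of `∨_{2^ℓ}` (`1` if `ℓ = 0` — `∨₁ = ∧₁` —, else `2`), its arity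
`2^ℓ`, then its `2^ℓ` re-addressed copies of the output wire (offset and word restarted from
`0`, the unary `2^ℓ` rebuilt by `mkLu`). [cite: Williams2014, Thm. 4.1] -/
def finalGateProg : Com PReg :=
  (ifNonempty pEu (setConst pX [false, true]) (setConst pX [true]) ;; emitReg pX po pcnt) ;;
  (emitReg pLN po pcnt ;; (clear pA ;; (clear pAW ;; (copy pEu pU2 (ra .t) (ra .u) ;; (fillFalse pAW pU2 ptk ;;
    (clear ptk ;; (mkLu ;; countLoop pLu outBody)))))))

/-- The cost of the final-gate phase. [folklore] -/
def finalGateCost (n s ℓ : ℕ) : ℕ :=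
  (3 + 3 + 12) + (4 * (ℓ + 1) + 4) + (2 * (2 ^ ℓ * (s + 2)) + 1) + (2 * ℓ + 1) + (10 * ℓ + 3) + (4 * ℓ + 1) +
    (2 * ℓ + 1) + (1 + (10 * ℓ + 3) + (ℓ * (7 * 2 ^ ℓ + 2 + 2) + 1)) +
    (2 ^ ℓ * (outStep n s ℓ (2 ^ ℓ * (s + 2)) + 2) + 1)

/-- The word of `0`. [folklore] -/
theorem natToWord_zero (w : ℕ) : natToWord w 0 = List.replicate w false := by
  simp [natToWord, List.ofFn_const]

/-- **Effect of the final-gate phase.** [cite: Williams2014, Thm. 4.1] -/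
theorem runs_finalGateProg {m ℓ : ℕ} (C : Circuit (Fin n)) (hℓn : ℓ ≤ n) (E : List (List Bool)) (σ : PRF)
    (hEu : σ.Eu = List.replicate ℓ true) (hLN : σ.LN = encodeNat (2 ^ ℓ)) (hLu : σ.Lu = [])
    (hTO : σ.TO = encodeNat (wtag C.output)) (hVO : σ.VO = encodeNat (wval C.output)) (hT : σ.T = []) (hV : σ.V = [])
    (hEL : σ.EL = encodeNat ℓ) (hSS : σ.SS = encodeNat (C.size + 2)) (hAr : σ.A = encodeNat (2 ^ ℓ * (C.size + 2)))
    (hAW : σ.AW = natToWord ℓ (2 ^ ℓ)) (ho : σ.o = outRev E) (hcnt : σ.cnt = List.replicate E.length true)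
    (hX : σ.X = []) (hF : σ.F = []) (hVu : σ.Vu = []) (htk : σ.tk = []) (hw : σ.w = []) (hU2 : σ.U2 = []) :
    Runs finalGateProg (base σ.regs)
      (base { σ with
        LN := []
        o := outRev (E ++ [encodeNat (accCode m (GateFn.or (2 ^ ℓ))), encodeNat (2 ^ ℓ)] ++
          ((List.range (2 ^ ℓ)).flatMap fun a => copyWire ℓ (a * (C.size + 2)) a C.output).map encodeNat)
        cnt := List.replicate (E ++ [encodeNat (accCode m (GateFn.or (2 ^ ℓ))), encodeNat (2 ^ ℓ)] ++
          ((List.range (2 ^ ℓ)).flatMap fun a => copyWire ℓ (a * (C.size + 2)) a C.output).map encodeNat).length true }.regs)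
      (finalGateCost n C.size ℓ) := by
  -- the code of the final gate
  set cd := accCode m (GateFn.or (2 ^ ℓ)) with hcd
  set σ₁ : PRF := { σ with X := encodeNat cd } with hσ₁
  have h1 : Runs (ifNonempty pEu (setConst pX [false, true]) (setConst pX [true])) (base σ.regs) (base σ₁.regs) (3 + 3) := by
    cases hℓ : ℓ with
    | zero =>
      have hX1 : encodeNat cd = [true] := by rw [hcd, accCode_or, hℓ, if_pos (pow_zero 2), encodeNat_one]
      subst hℓ
      refine (runs_ifNonempty_nil _ (by simp [hEu]) (runs_setConst pX [true] (base σ.regs))).of_eq ?_ (by simp [hX])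
      simp only [hσ₁, hX1]; simp
    | succ k =>
      have hne : 2 ^ (k + 1) ≠ 1 := by
        have : 2 ≤ 2 ^ (k + 1) := by rw [Nat.pow_succ]; have := Nat.one_le_two_pow (n := k); omega
        omega
      have hX2 : encodeNat cd = [false, true] := by rw [hcd, accCode_or, hℓ, if_neg hne, encodeNat_two]
      subst hℓ
      refine (runs_ifNonempty_cons _ (b := true) (rest := List.replicate k true) (by simp [hEu, List.replicate_succ])
        (runs_setConst pX [false, true] (base σ.regs))).of_eq ?_ (by simp [hX])
      simp only [hσ₁, hX2]; simp
  set E₂ := E ++ [encodeNat cd] with hE₂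
  set σ₂ : PRF := { σ with X := [], o := outRev E₂, cnt := List.replicate E₂.length true } with hσ₂
  have h2 : Runs (emitReg pX po pcnt) (base σ₁.regs) (base σ₂.regs) 12 := by
    have hl : (encodeNat cd).length ≤ 2 := by
      rw [hcd, accCode_or]; split_ifs <;> simp [encodeNat_one, encodeNat_two]
    have h := runs_emitReg (X := pX) (o := po) (cnt := pcnt) (by decide) (by decide) (by decide) E (encodeNat cd)
      (base σ₁.regs) (by simp [hσ₁]) (by simp [hσ₁, ho])
    refine h.of_eq ?_ (by omega)
    simp only [hσ₂, hσ₁, hE₂]; simp [List.replicate_succ, hcnt]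
  -- the arity
  set E₃ := E ++ [encodeNat cd, encodeNat (2 ^ ℓ)] with hE₃
  set σ₃ : PRF := { σ with X := [], LN := [], o := outRev E₃, cnt := List.replicate E₃.length true } with hσ₃
  have h3 : Runs (emitReg pLN po pcnt) (base σ₂.regs) (base σ₃.regs) (4 * (ℓ + 1) + 4) := by
    have h := runs_emitReg (X := pLN) (o := po) (cnt := pcnt) (by decide) (by decide) (by decide) E₂ (encodeNat (2 ^ ℓ))
      (base σ₂.regs) (by simp [hσ₂, hLN]) (by simp [hσ₂])
    refine h.of_eq ?_ (by simp [encodeNat_two_pow])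
    simp only [hσ₃, hσ₂, hE₃, hE₂, List.append_assoc, List.singleton_append]; simp [List.replicate_succ]
  -- restart offset and word
  set σ₄ : PRF := { σ₃ with A := [] } with hσ₄
  have h4 : Runs (clear pA) (base σ₃.regs) (base σ₄.regs) (2 * (2 ^ ℓ * (C.size + 2)) + 1) := by
    have hl := length_encodeNat_le_self (2 ^ ℓ * (C.size + 2))
    refine (runs_clear pA (base σ₃.regs)).of_eq ?_ (by simp [hσ₃, hAr]; omega)
    simp only [hσ₄, hσ₃]; simp
  set σ₅ : PRF := { σ₄ with AW := [] } with hσ₅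
  have h5 : Runs (clear pAW) (base σ₄.regs) (base σ₅.regs) (2 * ℓ + 1) := by
    refine (runs_clear pAW (base σ₄.regs)).of_eq ?_ (by simp [hσ₄, hσ₃, hAW, natToWord])
    simp only [hσ₅, hσ₄]; simp
  set σ₆ : PRF := { σ₅ with U2 := List.replicate ℓ true } with hσ₆
  have h6 : Runs (copy pEu pU2 (ra .t) (ra .u)) (base σ₅.regs) (base σ₆.regs) (10 * ℓ + 3) := by
    have h := runs_ocopy (β := POwn) (a := .Eu) (b := .U2) (by decide) σ₅.regs
    refine h.of_eq ?_ ?_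
    · simp only [hσ₆, hσ₅, hσ₄, hσ₃]; simp [hEu, hU2]
    · simp [hσ₅, hσ₄, hσ₃, hEu]
  set σ₇ : PRF := { σ₅ with AW := natToWord ℓ 0, tk := List.replicate ℓ true } with hσ₇
  have h7 : Runs (fillFalse pAW pU2 ptk) (base σ₆.regs) (base σ₇.regs) (4 * ℓ + 1) := by
    have h := runs_fillFalse (A := pAW) (U := pU2) (V := ptk) (by decide) (by decide) (by decide) ℓ (base σ₆.regs)
      (by simp [hσ₆])
    refine h.of_eq ?_ le_rfl
    simp only [hσ₇, hσ₆, hσ₅, hσ₄, hσ₃, natToWord_zero]; simp [htk, hU2]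
  set σ₈ : PRF := { σ₅ with AW := natToWord ℓ 0 } with hσ₈
  have h8 : Runs (clear ptk) (base σ₇.regs) (base σ₈.regs) (2 * ℓ + 1) := by
    refine (runs_clear ptk (base σ₇.regs)).of_eq ?_ (by simp [hσ₇])
    simp only [hσ₈, hσ₇, hσ₅, hσ₄, hσ₃]; simp [← htk]
  set σ₉ : PRF := { σ₈ with Lu := List.replicate (2 ^ ℓ) true } with hσ₉
  have h9 : Runs mkLu (base σ₈.regs) (base σ₉.regs) (1 + (10 * ℓ + 3) + (ℓ * (7 * 2 ^ ℓ + 2 + 2) + 1)) :=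
    runs_mkLu ℓ σ₈ (by simp [hσ₈, hσ₅, hσ₄, hσ₃, hEu]) (by simp [hσ₈, hσ₅, hσ₄, hσ₃, hLu]) (by simp [hσ₈, hσ₅, hσ₄, hσ₃, hU2])
      (by simp [hσ₈, hσ₅, hσ₄, hσ₃, htk])
  -- the output wires
  have h10 := runs_outLoop C hℓn (2 ^ ℓ) 0 (by simp) E₃ σ₉ (by simp [hσ₉]) (by simp [hσ₉, hσ₈, hσ₅, hσ₄, hσ₃, hTO])
    (by simp [hσ₉, hσ₈, hσ₅, hσ₄, hσ₃, hVO]) (by simp [hσ₉, hσ₈, hσ₅, hσ₄, hσ₃, hT]) (by simp [hσ₉, hσ₈, hσ₅, hσ₄, hσ₃, hV])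
    (by simp [hσ₉, hσ₈, hσ₅, hσ₄, hσ₃, hEL]) (by simp [hσ₉, hσ₈, hσ₅, hσ₄, hσ₃, hSS])
    (by simp [hσ₉, hσ₈, hσ₅, hσ₄, encodeNat_zero]) (by simp [hσ₉, hσ₈]) (by simp [hσ₉, hσ₈, hσ₅, hσ₄, hσ₃])
    (by simp [hσ₉, hσ₈, hσ₅, hσ₄, hσ₃]) (by simp [hσ₉, hσ₈, hσ₅, hσ₄, hσ₃]) (by simp [hσ₉, hσ₈, hσ₅, hσ₄, hσ₃, hF])
    (by simp [hσ₉, hσ₈, hσ₅, hσ₄, hσ₃, hVu]) (by simp [hσ₉, hσ₈, hσ₅, hσ₄, hσ₃, htk]) (by simp [hσ₉, hσ₈, hσ₅, hσ₄, hσ₃, hw])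
  rw [List.range'_eq_map_range, List.flatMap_map] at h10
  simp only [Nat.zero_add] at h10
  refine ((h1.seq h2).seq (h3.seq (h4.seq (h5.seq (h6.seq (h7.seq (h8.seq (h9.seq h10)))))))).of_eq ?_ ?_
  · simp only [hσ₉, hσ₈, hσ₅, hσ₄, hσ₃, hE₃]
    rw [hX, ← hAr, ← hAW, hLu]
  · unfold finalGateCost; omega

end PreprocP

end Literature.Computability.Complexity
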